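import Summits.CriticalPhenomena.PercolationContinuityZ3.Theorems.PercNearOneGluingNoHeavyLowerTailThreePointProductForm
import HarnessLib

/-!
# The product form from orbit counts, in the cell spelling (Sahi programme, prover prim-sahi-p2 gen 53, companion to `…ThreePointProductForm`)

Support file (`--supports stmt-CriticalPhenomena-4575`, helper).  Standard axioms, no sorries, no named facts, no definitions.  Referee finding
F259-1 (prim-sahi-ref gen 259): `ProductForm.halving_sqrt_of_orbitCounts` concludes with the cells spelled `{s↔a} ∩ {c↔a}ᶜ`, `{c↔a} ∩ {s↔a}ᶜ`
while `ProductForm.productForm_cells`, `sharp_halving_of_productForm_real`, `dichotomy_of_productForm_real` take `{s↔a} ∩ {s↔c}ᶜ`,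
`{c↔a} ∩ {c↔s}ᶜ` (equal sets).  This file glues them: from the per-class PRODUCT COUNTS of any weight-preserving finite family of maps of
`Ω × Ω` (e.g. the transplant recipes) one obtains in one step the product form `μ(U)μ(D) − μ(U∩D) ≤ √(μ(sa|c)·μ(ac|s))` in the cell spelling
(`productForm_of_orbitCounts`), the SHARP HALVING inequality `2μ(U)μ(D) ≤ 3μ(U∩D)` (`sharp_halving_of_orbitCounts`), Gladkov's dichotomy
with `δ = ε²/3` (`dichotomy_of_orbitCounts`) and the Conjecture-10.1 quantity bound `μ(sac)μ(s|a|c) − μ(sc|a)μ(ac|s) ≤ μ(sa|c) + √μ(sa|c)`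
(`conj101_of_orbitCounts`).  Everything is CONDITIONAL on the orbit-count hypothesis (conjecture (P) of gen 53: verified per G₃-orbit on
3.8·10⁷ orbits / 1.37·10⁶ fibres, kit j338968, and independently by the referee, R2659); nothing is asserted unconditionally.
[cite: Gladkov2024, Thm. 1.3 and Conjecture 10.1, arXiv:2408.08457] [this work]
-/

noncomputable section

open Classical

namespace Summit.CriticalPhenomena.PercolationContinuityZ3.Theorems

namespace ProductForm

open MeasureTheory Finset
open Literature.Probability.Percolation Literature.Probability.LatticeModels
open Literature.Probability.Percolation.BHK2006 (weight weight_nonneg)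

variable {V : Type*} [Fintype V]

/-! ### From orbit counts straight to the cell spelling -/

/-- **THE PRODUCT FORM FROM ORBIT COUNTS, in the cell spelling.**  Same hypothesis as `halving_sqrt_of_orbitCounts`; conclusion with the
cells written as `sa|c = {s↔a} ∩ {s↔c}ᶜ` and `ac|s = {c↔a} ∩ {c↔s}ᶜ` (equal sets), so that it feeds `productForm_cells`,
`sharp_halving_of_productForm_real` and `dichotomy_of_productForm_real` directly. [this work] -/
theorem productForm_of_orbitCounts (w : Sym2 V → unitInterval) (s a c : V) {ι : Type*} (W : Finset ι)
    (f : ι → BondConfig V × BondConfig V → BondConfig V × BondConfig V)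
    (hwf : ∀ i ∈ W, ∀ θ, weight (fun e => (w e : ℝ)) (f i θ).1 * weight (fun e => (w e : ℝ)) (f i θ).2 =
        weight (fun e => (w e : ℝ)) θ.1 * weight (fun e => (w e : ℝ)) θ.2)
    (hcount : ∀ O : Quot (Relation.EqvGen (fun x y : BondConfig V × BondConfig V => ∃ i ∈ W, y = f i x)),
      ((((Finset.univ.filter fun θ : BondConfig V × BondConfig V =>
            θ.1 ∈ (openConn s a ∪ openConn c a : Set (BondConfig V)) ∧ θ.2 ∈ ((openConn s c)ᶜ : Set (BondConfig V))).filter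
          fun θ => Quot.mk _ θ = O).card : ℕ) : ℝ) -
        (((Finset.univ.filter fun θ : BondConfig V × BondConfig V =>
            θ.1 ∈ ((openConn s a ∪ openConn c a) ∩ (openConn s c)ᶜ : Set (BondConfig V))).filter fun θ => Quot.mk _ θ = O).card : ℕ) ≤
        Real.sqrt ((((Finset.univ.filter fun θ : BondConfig V × BondConfig V =>
              θ.1 ∈ (openConn s a ∩ (openConn c a)ᶜ : Set (BondConfig V))).filter fun θ => Quot.mk _ θ = O).card : ℕ) *
          (((Finset.univ.filter fun θ : BondConfig V × BondConfig V =>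
              θ.1 ∈ (openConn c a ∩ (openConn s a)ᶜ : Set (BondConfig V))).filter fun θ => Quot.mk _ θ = O).card : ℕ))) :
    (prodBernoulli w).real (openConn s a ∪ openConn c a) * (prodBernoulli w).real ((openConn s c)ᶜ) -
        (prodBernoulli w).real ((openConn s a ∪ openConn c a) ∩ (openConn s c)ᶜ) ≤
      Real.sqrt ((prodBernoulli w).real (openConn s a ∩ (openConn s c)ᶜ) * (prodBernoulli w).real (openConn c a ∩ (openConn c s)ᶜ)) := by
  have h := halving_sqrt_of_orbitCounts w s a c W f hwf hcount
  have e1 : (openConn s a ∩ (openConn c a)ᶜ : Set (BondConfig V)) = openConn s a ∩ (openConn s c)ᶜ := by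
    ext ω
    simp only [Set.mem_inter_iff, Set.mem_compl_iff, openConn, Set.mem_setOf_eq]
    constructor
    · rintro ⟨h1, hca⟩; exact ⟨h1, fun hsc => hca (hsc.symm.trans h1)⟩
    · rintro ⟨h1, hsc⟩; exact ⟨h1, fun hca => hsc (h1.trans hca.symm)⟩
  have e2 : (openConn c a ∩ (openConn s a)ᶜ : Set (BondConfig V)) = openConn c a ∩ (openConn c s)ᶜ := by
    ext ω
    simp only [Set.mem_inter_iff, Set.mem_compl_iff, openConn, Set.mem_setOf_eq]
    constructor
    · rintro ⟨h1, hsa⟩; exact ⟨h1, fun hcs => hsa (hcs.symm.trans h1)⟩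
    · rintro ⟨h1, hcs⟩; exact ⟨h1, fun hsa => hcs (h1.trans hsa.symm)⟩
  rw [e1, e2] at h
  exact h

/-- **SHARP HALVING FROM ORBIT COUNTS**: the per-class product counts give `2·μ(U)·μ(D) ≤ 3·μ(U ∩ D)` on the weighted graph
(gen 44's constant 3/2; hence the halving lemma (v)). [this work] -/
theorem sharp_halving_of_orbitCounts (w : Sym2 V → unitInterval) (s a c : V) {ι : Type*} (W : Finset ι)
    (f : ι → BondConfig V × BondConfig V → BondConfig V × BondConfig V)
    (hwf : ∀ i ∈ W, ∀ θ, weight (fun e => (w e : ℝ)) (f i θ).1 * weight (fun e => (w e : ℝ)) (f i θ).2 =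
        weight (fun e => (w e : ℝ)) θ.1 * weight (fun e => (w e : ℝ)) θ.2)
    (hcount : ∀ O : Quot (Relation.EqvGen (fun x y : BondConfig V × BondConfig V => ∃ i ∈ W, y = f i x)),
      ((((Finset.univ.filter fun θ : BondConfig V × BondConfig V =>
            θ.1 ∈ (openConn s a ∪ openConn c a : Set (BondConfig V)) ∧ θ.2 ∈ ((openConn s c)ᶜ : Set (BondConfig V))).filter
          fun θ => Quot.mk _ θ = O).card : ℕ) : ℝ) -
        (((Finset.univ.filter fun θ : BondConfig V × BondConfig V =>
            θ.1 ∈ ((openConn s a ∪ openConn c a) ∩ (openConn s c)ᶜ : Set (BondConfig V))).filter fun θ => Quot.mk _ θ = O).card : ℕ) ≤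
        Real.sqrt ((((Finset.univ.filter fun θ : BondConfig V × BondConfig V =>
              θ.1 ∈ (openConn s a ∩ (openConn c a)ᶜ : Set (BondConfig V))).filter fun θ => Quot.mk _ θ = O).card : ℕ) *
          (((Finset.univ.filter fun θ : BondConfig V × BondConfig V =>
              θ.1 ∈ (openConn c a ∩ (openConn s a)ᶜ : Set (BondConfig V))).filter fun θ => Quot.mk _ θ = O).card : ℕ))) :
    2 * ((prodBernoulli w).real (openConn s a ∪ openConn c a) * (prodBernoulli w).real ((openConn s c)ᶜ)) ≤
      3 * (prodBernoulli w).real ((openConn s a ∪ openConn c a) ∩ (openConn s c)ᶜ) :=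
  sharp_halving_of_productForm_real w s a c (productForm_of_orbitCounts w s a c W f hwf hcount)

/-- **GLADKOV'S DICHOTOMY WITH QUADRATIC RATE FROM ORBIT COUNTS**: per-class product counts and `μ(sa|c), μ(ac|s) < ε²/3` give
`μ(sac) < ε ∨ μ(s|a|c) < ε`. [cite: Gladkov2024, Thm. 1.3] [this work] -/
theorem dichotomy_of_orbitCounts (w : Sym2 V → unitInterval) (s a c : V) {ι : Type*} (W : Finset ι)
    (f : ι → BondConfig V × BondConfig V → BondConfig V × BondConfig V)
    (hwf : ∀ i ∈ W, ∀ θ, weight (fun e => (w e : ℝ)) (f i θ).1 * weight (fun e => (w e : ℝ)) (f i θ).2 =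
        weight (fun e => (w e : ℝ)) θ.1 * weight (fun e => (w e : ℝ)) θ.2)
    (hcount : ∀ O : Quot (Relation.EqvGen (fun x y : BondConfig V × BondConfig V => ∃ i ∈ W, y = f i x)),
      ((((Finset.univ.filter fun θ : BondConfig V × BondConfig V =>
            θ.1 ∈ (openConn s a ∪ openConn c a : Set (BondConfig V)) ∧ θ.2 ∈ ((openConn s c)ᶜ : Set (BondConfig V))).filter
          fun θ => Quot.mk _ θ = O).card : ℕ) : ℝ) -
        (((Finset.univ.filter fun θ : BondConfig V × BondConfig V =>
            θ.1 ∈ ((openConn s a ∪ openConn c a) ∩ (openConn s c)ᶜ : Set (BondConfig V))).filter fun θ => Quot.mk _ θ = O).card : ℕ) ≤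
        Real.sqrt ((((Finset.univ.filter fun θ : BondConfig V × BondConfig V =>
              θ.1 ∈ (openConn s a ∩ (openConn c a)ᶜ : Set (BondConfig V))).filter fun θ => Quot.mk _ θ = O).card : ℕ) *
          (((Finset.univ.filter fun θ : BondConfig V × BondConfig V =>
              θ.1 ∈ (openConn c a ∩ (openConn s a)ᶜ : Set (BondConfig V))).filter fun θ => Quot.mk _ θ = O).card : ℕ)))
    {ε : ℝ} (hε : 0 < ε)
    (h1 : (prodBernoulli w).real (openConn s a ∩ (openConn s c)ᶜ) < ε ^ 2 / 3)
    (h2 : (prodBernoulli w).real (openConn c a ∩ (openConn c s)ᶜ) < ε ^ 2 / 3) :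
    (prodBernoulli w).real (openConn s a ∩ openConn s c) < ε ∨
      (prodBernoulli w).real ((openConn s a)ᶜ ∩ (openConn s c)ᶜ ∩ (openConn c a)ᶜ) < ε :=
  dichotomy_of_productForm_real w s a c hε (productForm_of_orbitCounts w s a c W f hwf hcount) h1 h2

/-- **GLADKOV'S CONJECTURE 10.1 QUANTITY FROM ORBIT COUNTS**: per-class product counts give
`μ(sac)·μ(s|a|c) − μ(sc|a)·μ(ac|s) ≤ μ(sa|c) + √μ(sa|c)` (so `μ(sa|c) < δ ⟹ … < δ + √δ`). [cite: Gladkov2024, Conjecture 10.1] [this work] -/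
theorem conj101_of_orbitCounts (w : Sym2 V → unitInterval) (s a c : V) {ι : Type*} (W : Finset ι)
    (f : ι → BondConfig V × BondConfig V → BondConfig V × BondConfig V)
    (hwf : ∀ i ∈ W, ∀ θ, weight (fun e => (w e : ℝ)) (f i θ).1 * weight (fun e => (w e : ℝ)) (f i θ).2 =
        weight (fun e => (w e : ℝ)) θ.1 * weight (fun e => (w e : ℝ)) θ.2)
    (hcount : ∀ O : Quot (Relation.EqvGen (fun x y : BondConfig V × BondConfig V => ∃ i ∈ W, y = f i x)),
      ((((Finset.univ.filter fun θ : BondConfig V × BondConfig V =>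
            θ.1 ∈ (openConn s a ∪ openConn c a : Set (BondConfig V)) ∧ θ.2 ∈ ((openConn s c)ᶜ : Set (BondConfig V))).filter
          fun θ => Quot.mk _ θ = O).card : ℕ) : ℝ) -
        (((Finset.univ.filter fun θ : BondConfig V × BondConfig V =>
            θ.1 ∈ ((openConn s a ∪ openConn c a) ∩ (openConn s c)ᶜ : Set (BondConfig V))).filter fun θ => Quot.mk _ θ = O).card : ℕ) ≤
        Real.sqrt ((((Finset.univ.filter fun θ : BondConfig V × BondConfig V =>
              θ.1 ∈ (openConn s a ∩ (openConn c a)ᶜ : Set (BondConfig V))).filter fun θ => Quot.mk _ θ = O).card : ℕ) *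
          (((Finset.univ.filter fun θ : BondConfig V × BondConfig V =>
              θ.1 ∈ (openConn c a ∩ (openConn s a)ᶜ : Set (BondConfig V))).filter fun θ => Quot.mk _ θ = O).card : ℕ))) :
    (prodBernoulli w).real (openConn s a ∩ openConn s c) *
        (prodBernoulli w).real ((openConn s a)ᶜ ∩ (openConn s c)ᶜ ∩ (openConn c a)ᶜ) -
        (prodBernoulli w).real (openConn s c ∩ (openConn s a)ᶜ) * (prodBernoulli w).real (openConn c a ∩ (openConn c s)ᶜ) ≤
      (prodBernoulli w).real (openConn s a ∩ (openConn s c)ᶜ) + Real.sqrt ((prodBernoulli w).real (openConn s a ∩ (openConn s c)ᶜ)) :=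
  (productForm_cells w s a c (productForm_of_orbitCounts w s a c W f hwf hcount)).2

end ProductForm

end Summit.CriticalPhenomena.PercolationContinuityZ3.Theorems

end
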